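import Literature.NumberTheory.GaloisRepresentations.LabelledWeightsTwist
import Literature.NumberTheory.GaloisRepresentations.UnramifiedAdmissible
import HarnessLib

/-!
# `dim_E D_τ(ρ) = n` for unramified representations with coefficients in a finite `E/ℚ_p`

Let `K` be a non-archimedean local field with a `ℚ_p`-algebra structure, `𝔅 = K̂_nr` the
unramified period-ring datum (`unramifiedPeriodRingData K p`), `E/ℚ_p` finite inside `ℚ̄_p`
splitting `K` (it contains every `τ(K)`, `τ : K →ₐ[ℚ_p] ℚ̄_p`) and `rE : Γ_K → GL_n(E)`
continuous and UNRAMIFIED.  We PROVE that every `τ`-component of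
`D(rE) = (Eⁿ ⊗_{ℚ_p} K̂_nr)^{Γ_K}` has `E`-dimension exactly `n`
(`finrank_labelD_eq_of_unramified`): i.e. `D(rE)` is free of rank `n` over `E ⊗_{ℚ_p} K`
(Fontaine; Patrikis §2.3.1), the input for "all labelled Hodge–Tate weights of an unramified
representation are `0` with multiplicity `n`".

Ingredients: admissibility of unramified representations (`UnramifiedAdmissible`), whence
`D` spans `K̂_nr ⊗ Eⁿ` over `K̂_nr` (`span_D_eq_top`, Fontaine injectivity + dimension) and
`dim_E D(rE) ≤ n [K : ℚ_p]` (`finite_coeffD_and_finrank_le`); the rank lower bound over the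
twisted period rings (`LabelledWeightsTwist`); counting.  Generic helper results for an arbitrary
datum: `span_D_eq_top`, `exists_sum_baseActB_eq_of_span_D_eq_top`, `coeffDEquivD`,
`finite_coeffD_and_finrank_le`.

No named facts, no `sorry`.

## References

* J.-M. Fontaine, Astérisque 223 (1994), Exp. III §1.5 and Prop. 1.6.2. [FontaineAsterisque223III]
* S. Patrikis, *Variations on a theorem of Tate*, Mem. AMS 258 (2019), §2.3.1. [Patrikis2019]
-/

noncomputable section

open TensorProduct Module

namespace Literature.NumberTheory.GaloisRepresentations

namespace PeriodRingData

universe u v v' w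

-- Mathlib's own global value of `maxSynthPendingDepth` (see `LabelledWeightsTwist`).
set_option maxSynthPendingDepth 3

section Generic

variable {Γ : Type u} [Group Γ] [TopologicalSpace Γ] {P : Type v} {F : Type v'} [Field P] [Field F] [Algebra P F]
  [TopologicalSpace P] (𝔅 : PeriodRingData.{u, v, v', _} Γ P F)

/-- **For a period FIELD `B`, an admissible `ρ` has `B · D(ρ) = B ⊗_P V`**: a `F`-basis of `D(ρ)`
is `B`-linearly independent (Fontaine) of the right cardinality. [cite: FontaineAsterisque223III, Exp. III §1.5] -/
theorem span_D_eq_top (hB : IsField 𝔅.B) {V : Type*} [AddCommGroup V] [Module P V] [TopologicalSpace V]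
    [FiniteDimensional P V] (ρP : ContinuousRep Γ P V) (hadm : 𝔅.IsAdmissible ρP) :
    Submodule.span 𝔅.B ((𝔅.D ρP : Set (𝔅.B ⊗[P] V))) = ⊤ := by
  letI : Field 𝔅.B := hB.toField
  have hD : Module.finrank F (𝔅.D ρP) = Module.finrank P V := hadm
  by_cases hN : Module.finrank P V = 0
  · haveI : Subsingleton V := Module.finrank_zero_iff.1 hN
    refine Submodule.eq_top_iff'.2 fun x => ?_
    have hx : x = 0 := by
      induction x using TensorProduct.induction_on with
      | zero => rfl
      | tmul b v => rw [Subsingleton.elim v 0, tmul_zero]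
      | add x y hx hy => rw [hx, hy, add_zero]
    rw [hx]
    exact zero_mem _
  · haveI : FiniteDimensional F (𝔅.D ρP) := Module.finite_of_finrank_pos (by omega)
    let b := Module.finBasis F (𝔅.D ρP)
    let w : Fin (Module.finrank F (𝔅.D ρP)) → 𝔅.B ⊗[P] V := fun j => (b j : 𝔅.B ⊗[P] V)
    have hwD : ∀ j, w j ∈ 𝔅.D ρP := fun j => (b j).2
    have hliF : LinearIndependent F w := b.linearIndependent.map' (𝔅.D ρP).subtype (Submodule.ker_subtype _)
    have hliB : LinearIndependent 𝔅.B w := 𝔅.linearIndependent_of_mem_D ρP hwD hliF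
    have hcard : Fintype.card (Fin (Module.finrank F (𝔅.D ρP))) = Module.finrank 𝔅.B (𝔅.B ⊗[P] V) := by
      rw [Fintype.card_fin, hD, Module.finrank_baseChange]
    have hspan := hliB.span_eq_top_of_card_eq_finrank' hcard
    refine eq_top_iff.2 (hspan ▸ Submodule.span_mono ?_)
    rintro _ ⟨j, rfl⟩
    exact hwD j

variable {E : Type w} [Field E] [Algebra P E] [TopologicalSpace E]

/-- If `D(ρ)` spans over `B`, the standard vectors `e_i ⊗ 1` are `B`-combinations of elements of
`D(ρ) ⊆ M ⊗_P B` (transport along `TensorProduct.comm`). [folklore] -/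
theorem exists_sum_baseActB_eq_of_span_D_eq_top {n : ℕ} (ρ : ContinuousRep Γ E (Fin n → E))
    (h : Submodule.span 𝔅.B ((𝔅.D (ρ.restrictScalars P) : Set (𝔅.B ⊗[P] (Fin n → E)))) = ⊤) (i : Fin n) :
    ∃ (k : ℕ) (b : Fin k → 𝔅.B) (x : Fin k → (Fin n → E) ⊗[P] 𝔅.B),
      (∀ j, x j ∈ 𝔅.coeffD ρ) ∧ ∑ j, 𝔅.baseActB E (Fin n → E) (b j) (x j) = (Pi.single i (1 : E)) ⊗ₜ[P] (1 : 𝔅.B) := by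
  have hz : TensorProduct.comm P (Fin n → E) 𝔅.B ((Pi.single i (1 : E)) ⊗ₜ[P] (1 : 𝔅.B)) ∈
      Submodule.span 𝔅.B ((𝔅.D (ρ.restrictScalars P) : Set (𝔅.B ⊗[P] (Fin n → E)))) := by
    rw [h]; trivial
  obtain ⟨k, f, g, hsum⟩ := Submodule.mem_span_set'.1 hz
  refine ⟨k, f, fun j => (TensorProduct.comm P (Fin n → E) 𝔅.B).symm (g j), fun j => ?_, ?_⟩
  · rw [mem_coeffD_iff_comm_mem_D, LinearEquiv.apply_symm_apply]
    exact (g j).2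
  · apply (TensorProduct.comm P (Fin n → E) 𝔅.B).injective
    rw [map_sum, ← hsum]
    refine Finset.sum_congr rfl fun j _ => ?_
    rw [← LinearEquiv.apply_symm_apply (TensorProduct.comm P (Fin n → E) 𝔅.B) (f j • (g j : 𝔅.B ⊗[P] (Fin n → E))),
      𝔅.comm_symm_smul E (Fin n → E) (f j)]

/-- **`D(ρ)` with coefficients is `D` of the restriction of scalars**, as `P`-vector spaces
(along `TensorProduct.comm`). [folklore] -/
def coeffDEquivD {M : Type*} [AddCommGroup M] [Module E M] [Module P M] [IsScalarTower P E M] [TopologicalSpace M]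
    (ρ : ContinuousRep Γ E M) : 𝔅.coeffD ρ ≃ₗ[P] 𝔅.D (ρ.restrictScalars P) where
  toFun x := ⟨TensorProduct.comm P M 𝔅.B x, (𝔅.mem_coeffD_iff_comm_mem_D ρ x).1 x.2⟩
  map_add' x y := Subtype.ext (by simp)
  map_smul' c x := Subtype.ext (by simp)
  invFun y := ⟨(TensorProduct.comm P M 𝔅.B).symm y,
    (𝔅.mem_coeffD_iff_comm_mem_D ρ _).2 (by rw [LinearEquiv.apply_symm_apply]; exact y.2)⟩
  left_inv x := Subtype.ext (by simp)
  right_inv y := Subtype.ext (by simp)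

/-- **`dim_E D(ρ) ≤ n [F : P]`** (and `D(ρ)` is finite-dimensional) for `E/P` finite, from
`dim_F D ≤ dim_P Eⁿ` (Fontaine's inequality), counting `P`-dimensions two ways. [folklore] -/
theorem finite_coeffD_and_finrank_le [FiniteDimensional P E] [FiniteDimensional P F] {n : ℕ}
    (ρ : ContinuousRep Γ E (Fin n → E)) [Module.Finite F (𝔅.D (ρ.restrictScalars P))]
    (hle : Module.finrank F (𝔅.D (ρ.restrictScalars P)) ≤ Module.finrank P (Fin n → E)) :
    Module.Finite E (𝔅.coeffD ρ) ∧ Module.finrank E (𝔅.coeffD ρ) ≤ n * Module.finrank P F := by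
  let e := 𝔅.coeffDEquivD ρ
  haveI : Module.Finite P (𝔅.D (ρ.restrictScalars P)) := Module.Finite.trans F _
  haveI : Module.Finite P (𝔅.coeffD ρ) := Module.Finite.equiv e.symm
  haveI hfin : Module.Finite E (𝔅.coeffD ρ) := Module.Finite.of_restrictScalars_finite P E _
  refine ⟨hfin, ?_⟩
  have h1 : Module.finrank P E * Module.finrank E (𝔅.coeffD ρ) = Module.finrank P (𝔅.coeffD ρ) :=
    Module.finrank_mul_finrank P E (𝔅.coeffD ρ)
  have h2 : Module.finrank P F * Module.finrank F (𝔅.D (ρ.restrictScalars P)) = Module.finrank P (𝔅.D (ρ.restrictScalars P)) :=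
    Module.finrank_mul_finrank P F _
  have h3 : Module.finrank P (𝔅.coeffD ρ) = Module.finrank P (𝔅.D (ρ.restrictScalars P)) := e.finrank_eq
  have h4 : Module.finrank P (Fin n → E) = n * Module.finrank P E := by
    rw [Module.finrank_pi_fintype, Finset.sum_const, Finset.card_univ, Fintype.card_fin, smul_eq_mul]
  have hpos : 0 < Module.finrank P E := Module.finrank_pos
  have h5 : Module.finrank P E * Module.finrank E (𝔅.coeffD ρ) ≤ Module.finrank P E * (n * Module.finrank P F) := by
    calc Module.finrank P E * Module.finrank E (𝔅.coeffD ρ)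
        = Module.finrank P F * Module.finrank F (𝔅.D (ρ.restrictScalars P)) := by rw [h1, h3, h2]
      _ ≤ Module.finrank P F * (n * Module.finrank P E) := Nat.mul_le_mul_left _ (h4 ▸ hle)
      _ = Module.finrank P E * (n * Module.finrank P F) := by ring
  exact Nat.le_of_mul_le_mul_left h5 hpos

end Generic

/-! ### The unramified datum -/

section Unramified

open IsNonarchimedeanLocalField Field

variable {K : Type} [Field K] [ValuativeRel K] [TopologicalSpace K] [IsNonarchimedeanLocalField K]
  {p : ℕ} [Fact p.Prime] [Algebra ℚ_[p] K]

set_option synthInstance.maxHeartbeats 200000 in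
/-- **`dim_E D_τ(rE) = n` for unramified `rE : Γ_K → GL_n(E)`** with `E/ℚ_p` finite splitting `K`,
relative to the unramified period-ring datum `K̂_nr`: `D(rE) = (Eⁿ ⊗_{ℚ_p} K̂_nr)^{Γ_K}` is free
of rank `n` over `E ⊗_{ℚ_p} K`. [cite: FontaineAsterisque223III, Exp. III Prop. 1.6.2] [cite: Patrikis2019, §2.3.1] -/
theorem finrank_labelD_eq_of_unramified [FiniteDimensional ℚ_[p] K] (E : IntermediateField ℚ_[p] (PadicAlgCl p))
    [FiniteDimensional ℚ_[p] E] (hsplit : Fintype.card (K →ₐ[ℚ_[p]] E) = Module.finrank ℚ_[p] K) {n : ℕ}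
    (rE : FramedRep (absoluteGaloisGroup K) E n) (hunr : ∀ σ ∈ absInertia K, rE σ = 1) (τ : K →ₐ[ℚ_[p]] E) :
    Module.finrank E ((unramifiedPeriodRingData K p).labelD (FramedRep.toContinuousRep rE) τ.toRingHom) = n := by
  haveI : ContinuousSMul ℚ_[p] E := IntermediateField.continuousSMul_padicAlgCl E
  have hρ : ∀ σ ∈ absInertia K, ∀ v : Fin n → E, ((FramedRep.toContinuousRep rE).restrictScalars ℚ_[p]) σ v = v := by
    intro σ hσ v
    rw [ContinuousRep.restrictScalars_apply, FramedRep.toContinuousRep_apply_apply, hunr σ hσ, Units.val_one, Matrix.one_mulVec]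
  have hadm : (unramifiedPeriodRingData K p).IsAdmissible ((FramedRep.toContinuousRep rE).restrictScalars ℚ_[p]) :=
    isAdmissible_unramifiedPeriodRingData_of_unramified K p _ hρ
  haveI : Module.Finite K ((unramifiedPeriodRingData K p).D ((FramedRep.toContinuousRep rE).restrictScalars ℚ_[p])) :=
    Module.rank_lt_aleph0_iff.1 (((unramifiedPeriodRingData K p).rank_D_le _).trans_lt Cardinal.natCast_lt_aleph0)
  have hDeq : Module.finrank K ((unramifiedPeriodRingData K p).D ((FramedRep.toContinuousRep rE).restrictScalars ℚ_[p])) =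
      Module.finrank ℚ_[p] (Fin n → E) := hadm
  obtain ⟨hfinC, htotal⟩ := (unramifiedPeriodRingData K p).finite_coeffD_and_finrank_le (FramedRep.toContinuousRep rE) hDeq.le
  haveI := hfinC
  have hB : IsField (unramifiedPeriodRingData K p).B := Field.toIsField (unramifiedPeriodField K)
  exact (unramifiedPeriodRingData K p).finrank_labelD_eq_of_finrank_coeffD_le (FramedRep.toContinuousRep rE) hsplit
    ((unramifiedPeriodRingData K p).exists_sum_baseActB_eq_of_span_D_eq_top (FramedRep.toContinuousRep rE)
      ((unramifiedPeriodRingData K p).span_D_eq_top hB _ hadm)) htotal τ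

end Unramified

end PeriodRingData

end Literature.NumberTheory.GaloisRepresentations

end
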